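import Mathlib
import Literature.AlgebraicGeometry.Tropical.TorusCycles
import HarnessLib

/-!
# Crux `TropicalWeilVanishing` (stmt-HodgeConjecture-18478), line `identity_transfer` — integer linear
# algebra of frames for the registered stub `stub_transportToIdentity` (isogeny transport)

Route `TropicalWeilObstruction` of `HodgeConjecture`. Self-contained lemmas about the integer frames
`L ∈ M_{g×p}(ℤ)` of framed lattice simplices (Mikhalkin–Zharkov Def. 4.2) under a linear change of
slope lattice `x ↦ F x`, `F ∈ M_g(ℤ)`, `det F ≠ 0`:

* `pluckerCoord_mul` — `Plücker(L' R) = Plücker(L') · det R` (column operations);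
* `pluckerCoord_left_mul` — ROW EXPANSION `Plücker(F L)(S) = Σ_τ (∏ᵢ F_{S i, τ i}) · Plücker(L)(τ)`
  (multilinearity of the determinant in the rows), the form of Cauchy–Binet that transports the
  balancing certificate of a tropical cycle along `x ↦ F x` (`balanced_transport`);
* `exists_saturation` — RE-SATURATION: an integer `g × p` matrix `A` with independent columns factors
  as `A = L' R` with `L'` saturated (a left inverse over `ℤ`), `R ∈ M_p(ℤ)`, `det R > 0`
  (Smith normal form of the column lattice inside `ℤᵍ`);
* `complexOf_mul`, `frameComplexDet_left_mul`, `frameComplexDet_mul_right`, `complexOf_det_ne_zero` —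
  for the Weil family (`g = 2n`, `z_k = x_k + i x_{k+n}`): a `J`-commuting integer `F = [[A, -C], [C, A]]`
  acts `ℂ`-linearly, `η(F L) = det(A + iC) · η(L)`, `η(L' R) = η(L') · det R`, and `det(A + iC) ≠ 0`
  when `det F ≠ 0` — so the Weil functional `W = Σ w a η²` of a transported cycle is `det(A + iC)²`
  times the old one.

Mathlib only; no definition, no named fact, no sorry.

## References

* [MikhalkinZharkov2014Eigenwave] G. Mikhalkin, I. Zharkov, Tropical eigenwave and intermediate
  Jacobians, LN UMI 15 (2014), Def. 4.2, Prop. 4.3.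
* [Zharkov2020TropicalWeil] I. Zharkov, Tropical abelian varieties, Weil classes and the Hodge
  conjecture, arXiv:2002.02347 (2020), §2.
-/

-- `Summit.HodgeConjecture.HodgeConjecture.…` is the mandated namespace (single-conjunct summit).
set_option linter.dupNamespace false

noncomputable section

open scoped BigOperators Matrix
open Matrix Literature.AlgebraicGeometry.Tropical

namespace Summit.HodgeConjecture.HodgeConjecture.Theorems.TropicalWeilVanishing

variable {g p : ℕ}

/-! ### Plücker coordinates under column and row operations -/

/-- **Column operations scale Plücker coordinates by the determinant**: `Plücker(L' R)(S) =
Plücker(L')(S) · det R`. [folklore] -/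
theorem pluckerCoord_mul (L' : Matrix (Fin g) (Fin p) ℤ) (R : Matrix (Fin p) (Fin p) ℤ)
    (S : Fin p → Fin g) : pluckerCoord (L' * R) S = pluckerCoord L' S * R.det := by
  unfold pluckerCoord
  rw [Matrix.submatrix_mul L' R S id id Function.bijective_id, Matrix.submatrix_id_id,
    Matrix.det_mul]

/-- **Row expansion of the Plücker coordinates of `F L`** (the determinant is multilinear in the
rows): `Plücker(F L)(S) = Σ_{τ : Fin p → Fin g} (∏ᵢ F_{S i, τ i}) · Plücker(L)(τ)`. [folklore] -/
theorem pluckerCoord_left_mul (F : Matrix (Fin g) (Fin g) ℤ) (L : Matrix (Fin g) (Fin p) ℤ)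
    (S : Fin p → Fin g) :
    pluckerCoord (F * L) S = ∑ τ : Fin p → Fin g, (∏ i, F (S i) (τ i)) * pluckerCoord L τ := by
  classical
  unfold pluckerCoord
  have hrows : ((F * L).submatrix S id : Fin p → Fin p → ℤ) =
      fun i => ∑ a : Fin g, F (S i) a • (L a : Fin p → ℤ) := by
    funext i j
    simp [Matrix.submatrix_apply, Matrix.mul_apply, Finset.sum_apply]
  have h1 : ((F * L).submatrix S id).det =
      Matrix.detRowAlternating (fun i => ∑ a : Fin g, F (S i) a • (L a : Fin p → ℤ)) := by
    rw [← hrows]; rfl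
  rw [h1]
  have h2 := (Matrix.detRowAlternating : (Fin p → ℤ) [⋀^Fin p]→ₗ[ℤ] ℤ).toMultilinearMap.map_sum
    (fun i (a : Fin g) => F (S i) a • (L a : Fin p → ℤ))
  rw [AlternatingMap.coe_multilinearMap] at h2
  rw [h2]
  refine Finset.sum_congr rfl fun τ _ => ?_
  have h3 := (Matrix.detRowAlternating : (Fin p → ℤ) [⋀^Fin p]→ₗ[ℤ] ℤ).toMultilinearMap.map_smul_univ
    (fun i => F (S i) (τ i)) (fun i => (L (τ i) : Fin p → ℤ))
  rw [AlternatingMap.coe_multilinearMap] at h3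
  rw [h3, smul_eq_mul]
  rfl

/-! ### Re-saturation of frames (Smith normal form) -/

/-- **Re-saturation.** An integer `g × p` matrix `A` with `ℤ`-independent columns factors as
`A = L' · R` with `L'` SATURATED (its columns extend to a basis of `ℤᵍ`: a left inverse over `ℤ`),
`R ∈ M_p(ℤ)` and `det R > 0`: take a Smith normal form basis of the column lattice of `A` inside
`ℤᵍ` and fix the orientation by a sign. [folklore] -/
theorem exists_saturation (A : Matrix (Fin g) (Fin p) ℤ)
    (hA : ∀ x : Fin p → ℤ, A *ᵥ x = 0 → x = 0) :
    ∃ (L' : Matrix (Fin g) (Fin p) ℤ) (R : Matrix (Fin p) (Fin p) ℤ),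
      A = L' * R ∧ 0 < R.det ∧ ∃ M : Matrix (Fin p) (Fin g) ℤ, M * L' = 1 := by
  classical
  -- it suffices to find a factorisation with `det R ≠ 0` (then fix the sign)
  suffices h : ∃ (L' : Matrix (Fin g) (Fin p) ℤ) (R : Matrix (Fin p) (Fin p) ℤ),
      A = L' * R ∧ R.det ≠ 0 ∧ ∃ M : Matrix (Fin p) (Fin g) ℤ, M * L' = 1 by
    obtain ⟨L', R, hA', hR, M, hM⟩ := h
    rcases lt_or_gt_of_ne hR with hneg | hpos
    · -- flip the orientation of the first column (there is one: `det` of a `0 × 0` matrix is `1`)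
      have hp : 0 < p := by
        rcases Nat.eq_zero_or_pos p with h0 | h0
        · subst h0
          exfalso
          have : R.det = 1 := by simp [Matrix.det_isEmpty]
          linarith
        · exact h0
      let D : Matrix (Fin p) (Fin p) ℤ := Matrix.diagonal fun i => if i = ⟨0, hp⟩ then -1 else 1
      have hDD : D * D = 1 := by
        rw [Matrix.diagonal_mul_diagonal, ← Matrix.diagonal_one]
        congr 1
        funext i
        split_ifs <;> simp
      have hDdet : D.det = -1 := by
        rw [Matrix.det_diagonal, Finset.prod_eq_single ⟨0, hp⟩]
        · simp
        · intro i _ hi; simp [hi]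
        · intro h; exact absurd (Finset.mem_univ _) h
      refine ⟨L' * D, D * R, ?_, ?_, D * M, ?_⟩
      · rw [Matrix.mul_assoc, ← Matrix.mul_assoc D, hDD, Matrix.one_mul, hA']
      · rw [Matrix.det_mul, hDdet]; linarith
      · rw [Matrix.mul_assoc, ← Matrix.mul_assoc M, hM, Matrix.one_mul, hDD]
    · exact ⟨L', R, hA', hpos, M, hM⟩
  -- the column lattice `N` of `A` and a Smith normal form basis of it inside `ℤᵍ`
  let N : Submodule ℤ (Fin g → ℤ) := LinearMap.range A.mulVecLin
  have hinj : Function.Injective A.mulVecLin := by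
    intro x y hxy
    have h := hA (x - y) (by rw [Matrix.mulVec_sub]; exact sub_eq_zero.2 hxy)
    exact sub_eq_zero.1 h
  obtain ⟨n, snf⟩ := Submodule.smithNormalForm (Pi.basisFun ℤ (Fin g)) N
  have hn : n = p := by
    have h1 : Module.finrank ℤ N = n := by
      rw [Module.finrank_eq_card_basis snf.bN, Fintype.card_fin]
    have h2 : Module.finrank ℤ N = p := by
      rw [LinearMap.finrank_range_of_inj hinj, Module.finrank_pi, Fintype.card_fin]
    omega
  subst hn
  -- the saturated basis vectors `bM (f i)` and their dual coordinates
  set L' : Matrix (Fin g) (Fin n) ℤ := Matrix.of fun a i => snf.bM (snf.f i) a with hL'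
  set R : Matrix (Fin n) (Fin n) ℤ := Matrix.of fun i j =>
      snf.a i * snf.bN.repr ⟨A.mulVecLin (Pi.single j 1), LinearMap.mem_range_self _ _⟩ i with hR
  -- `A = L' R`: expand the columns of `A` in the basis `bN = (a i • bM (f i))` of `N`
  have hfact : A = L' * R := by
    ext a j
    have hgen : ∀ m : N, (m : Fin g → ℤ) = ∑ i, snf.bN.repr m i • ((snf.bN i : N) : Fin g → ℤ) := by
      intro m
      conv_lhs => rw [← snf.bN.sum_repr m]
      simp only [Submodule.coe_sum, Submodule.coe_smul_of_tower]
    have hcol := hgen ⟨A.mulVecLin (Pi.single j 1), LinearMap.mem_range_self _ _⟩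
    have hAaj : A a j = (A.mulVecLin (Pi.single j 1) : Fin g → ℤ) a := by simp
    rw [hAaj, Matrix.mul_apply]
    change ((⟨A.mulVecLin (Pi.single j 1), LinearMap.mem_range_self _ _⟩ : N) : Fin g → ℤ) a = _
    rw [hcol, Finset.sum_apply]
    refine Finset.sum_congr rfl fun i _ => ?_
    rw [snf.snf i]
    simp only [Pi.smul_apply, smul_eq_mul, hL', hR, Matrix.of_apply]
    ring
  refine ⟨L', R, hfact, ?_, Matrix.of fun i a => snf.bM.coord (snf.f i) (Pi.single a 1), ?_⟩
  · -- `det R ≠ 0`: `R x = 0 ⟹ A x = L' (R x) = 0 ⟹ x = 0`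
    intro hdet
    obtain ⟨x, hx0, hRx⟩ := Matrix.exists_mulVec_eq_zero_iff.2 hdet
    exact hx0 (hA x (by rw [hfact, ← Matrix.mulVec_mulVec, hRx, Matrix.mulVec_zero]))
  · -- `M L' = 1`
    ext i j
    rw [Matrix.mul_apply, Matrix.one_apply]
    have hv : ∀ v : Fin g → ℤ, ∑ a, v a • (Pi.single a (1 : ℤ) : Fin g → ℤ) = v := by
      intro v; ext b; simp [Finset.sum_apply, Pi.single_apply]
    have h : ∑ a, snf.bM.coord (snf.f i) (Pi.single a 1) * snf.bM (snf.f j) a =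
        snf.bM.coord (snf.f i) (snf.bM (snf.f j)) := by
      conv_rhs => rw [← hv (snf.bM (snf.f j)), map_sum]
      refine Finset.sum_congr rfl fun a _ => ?_
      rw [map_smul, smul_eq_mul, mul_comm]
    simp only [hL', Matrix.of_apply]
    rw [h, snf.bM.coord_apply, snf.bM.repr_self, Finsupp.single_apply]
    simp [eq_comm]

/-! ### Transport of the balancing certificate -/

/-- **The balancing certificate survives `x ↦ F x` after re-saturation.** If the signed weighted
frames cancel class by class (`Σ ± w_σ · vol(L_σ) = 0` in `⋀ᵖ ℤᵍ`, one equation per Plücker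
coordinate), `F L_σ = L'_σ R_σ`, and the new weights are `w_σ · det R_σ`, then the new signed weighted
frames `Σ ± w_σ det R_σ · vol(L'_σ)` cancel as well: `det R_σ · vol(L'_σ) = vol(F L_σ) = ⋀ᵖF (vol L_σ)`
is linear in `vol L_σ` (row expansion). [cite: MikhalkinZharkov2014Eigenwave, Def. 4.2 and Prop. 4.3] -/
theorem balanced_transport {Nc Nf : ℕ} (w : Fin Nc → ℤ) (L : Fin Nc → Matrix (Fin g) (Fin p) ℤ)
    (cls : Fin Nc → Fin (p + 1) → Fin Nf) (sgn : Fin Nc → Fin (p + 1) → ℤ)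
    (hbal : ∀ (f : Fin Nf) (S : Fin p → Fin g),
      (∑ σ, ∑ i : Fin (p + 1),
        if cls σ i = f then w σ * (-1) ^ (i : ℕ) * sgn σ i * pluckerCoord (L σ) S else 0) = 0)
    (F : Matrix (Fin g) (Fin g) ℤ) (L' : Fin Nc → Matrix (Fin g) (Fin p) ℤ)
    (R : Fin Nc → Matrix (Fin p) (Fin p) ℤ) (hfac : ∀ σ, F * L σ = L' σ * R σ)
    (f : Fin Nf) (S : Fin p → Fin g) :
    (∑ σ, ∑ i : Fin (p + 1),
      if cls σ i = f then w σ * (R σ).det * (-1) ^ (i : ℕ) * sgn σ i * pluckerCoord (L' σ) S else 0) = 0 := by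
  classical
  have key : ∀ (σ : Fin Nc) (i : Fin (p + 1)),
      (if cls σ i = f then w σ * (R σ).det * (-1) ^ (i : ℕ) * sgn σ i * pluckerCoord (L' σ) S else 0) =
        ∑ τ : Fin p → Fin g, (∏ i, F (S i) (τ i)) *
          (if cls σ i = f then w σ * (-1) ^ (i : ℕ) * sgn σ i * pluckerCoord (L σ) τ else 0) := by
    intro σ i
    split_ifs with h
    · have e : (R σ).det * pluckerCoord (L' σ) S =
          ∑ τ : Fin p → Fin g, (∏ i, F (S i) (τ i)) * pluckerCoord (L σ) τ := by
        rw [mul_comm, ← pluckerCoord_mul, ← hfac σ, pluckerCoord_left_mul]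
      calc w σ * (R σ).det * (-1) ^ (i : ℕ) * sgn σ i * pluckerCoord (L' σ) S
          = w σ * (-1) ^ (i : ℕ) * sgn σ i * ((R σ).det * pluckerCoord (L' σ) S) := by ring
        _ = ∑ τ : Fin p → Fin g, (∏ i, F (S i) (τ i)) *
              (w σ * (-1) ^ (i : ℕ) * sgn σ i * pluckerCoord (L σ) τ) := by
          rw [e, Finset.mul_sum]
          exact Finset.sum_congr rfl fun τ _ => by ring
    · simp
  have hrew : (∑ σ, ∑ i : Fin (p + 1),
      if cls σ i = f then w σ * (R σ).det * (-1) ^ (i : ℕ) * sgn σ i * pluckerCoord (L' σ) S else 0) =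
      ∑ τ : Fin p → Fin g, (∏ i, F (S i) (τ i)) *
        ∑ σ, ∑ i : Fin (p + 1),
          if cls σ i = f then w σ * (-1) ^ (i : ℕ) * sgn σ i * pluckerCoord (L σ) τ else 0 := by
    simp_rw [key, Finset.mul_sum]
    symm
    rw [Finset.sum_comm]
    exact Finset.sum_congr rfl fun σ _ => Finset.sum_comm
  rw [hrew]
  exact Finset.sum_eq_zero fun τ _ => by rw [hbal f τ, mul_zero]

/-! ### The complex structure: `ℂ`-linear integer matrices and `η = frameComplexDet` -/

section Complex

variable {n : ℕ}

/-- A sum over `Fin (2n)` splits into the two halves `k` and `k + n`, `k < n`. [folklore] -/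
theorem sum_fin_two_mul {M : Type*} [AddCommMonoid M] (f : Fin (2 * n) → M) :
    ∑ c, f c = ∑ k : Fin n, f ⟨(k : ℕ), by omega⟩ + ∑ k : Fin n, f ⟨(k : ℕ) + n, by omega⟩ := by
  have h2 : n + n = 2 * n := (two_mul n).symm
  rw [← Equiv.sum_comp (finCongr h2) f, Fin.sum_univ_add]
  refine congrArg₂ (· + ·) ?_ ?_
  · exact Finset.sum_congr rfl fun k _ => congrArg f (Fin.ext (by simp))
  · exact Finset.sum_congr rfl fun k _ => congrArg f (Fin.ext (by simp [add_comm]))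

/-- **`ℂ`-linearity of a `J`-commuting integer matrix.** If `F ∈ M_{2n}(ℤ)` has the block shape
`F = [[A, -C], [C, A]]` (i.e. commutes with `J`), then for any integer matrix `G` and any choice of
`n` columns `c`, the complex `n × n` matrix `(z_k)` of the columns of `F G` (`z_k = x_k + i x_{k+n}`)
is `(A + iC)` times that of `G`. [cite: Zharkov2020TropicalWeil, §2 (pp. 2–4)] -/
theorem complexOf_mul {ι : Type*} [Fintype ι] (F : Matrix (Fin (2 * n)) (Fin (2 * n)) ℤ)
    (hF1 : ∀ a b : Fin n, F ⟨(a : ℕ) + n, by omega⟩ ⟨(b : ℕ) + n, by omega⟩ = F ⟨(a : ℕ), by omega⟩ ⟨(b : ℕ), by omega⟩)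
    (hF2 : ∀ a b : Fin n, F ⟨(a : ℕ), by omega⟩ ⟨(b : ℕ) + n, by omega⟩ = -F ⟨(a : ℕ) + n, by omega⟩ ⟨(b : ℕ), by omega⟩)
    (G : Matrix (Fin (2 * n)) ι ℤ) (c : Fin n → ι) :
    (Matrix.of fun k b : Fin n =>
        (((F * G) ⟨(k : ℕ), by omega⟩ (c b) : ℤ) : ℂ) +
          (((F * G) ⟨(k : ℕ) + n, by omega⟩ (c b) : ℤ) : ℂ) * Complex.I) =
      (Matrix.of fun k j : Fin n =>
        ((F ⟨(k : ℕ), by omega⟩ ⟨(j : ℕ), by omega⟩ : ℤ) : ℂ) +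
          ((F ⟨(k : ℕ) + n, by omega⟩ ⟨(j : ℕ), by omega⟩ : ℤ) : ℂ) * Complex.I) *
      (Matrix.of fun j b : Fin n =>
        ((G ⟨(j : ℕ), by omega⟩ (c b) : ℤ) : ℂ) + ((G ⟨(j : ℕ) + n, by omega⟩ (c b) : ℤ) : ℂ) * Complex.I) := by
  ext k b
  simp only [Matrix.of_apply, Matrix.mul_apply]
  rw [sum_fin_two_mul (fun x => F ⟨(k : ℕ), by omega⟩ x * G x (c b)),
    sum_fin_two_mul (fun x => F ⟨(k : ℕ) + n, by omega⟩ x * G x (c b))]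
  push_cast
  rw [← Finset.sum_add_distrib, ← Finset.sum_add_distrib, Finset.sum_mul, ← Finset.sum_add_distrib]
  refine Finset.sum_congr rfl fun j _ => ?_
  rw [hF1 k j, hF2 k j]
  push_cast
  have hI : Complex.I * Complex.I = -1 := Complex.I_mul_I
  linear_combination (-(((F ⟨(k : ℕ) + n, by omega⟩ ⟨(j : ℕ), by omega⟩ : ℤ) : ℂ) *
    ((G ⟨(j : ℕ) + n, by omega⟩ (c b) : ℤ) : ℂ))) * hI

/-- `η(F L) = det(A + iC) · η(L)` for a `J`-commuting integer `F = [[A, -C], [C, A]]`.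
[cite: Zharkov2020TropicalWeil, §2 (pp. 2–4)] -/
theorem frameComplexDet_left_mul (F : Matrix (Fin (2 * n)) (Fin (2 * n)) ℤ)
    (hF1 : ∀ a b : Fin n, F ⟨(a : ℕ) + n, by omega⟩ ⟨(b : ℕ) + n, by omega⟩ = F ⟨(a : ℕ), by omega⟩ ⟨(b : ℕ), by omega⟩)
    (hF2 : ∀ a b : Fin n, F ⟨(a : ℕ), by omega⟩ ⟨(b : ℕ) + n, by omega⟩ = -F ⟨(a : ℕ) + n, by omega⟩ ⟨(b : ℕ), by omega⟩)
    (L : Matrix (Fin (2 * n)) (Fin n) ℤ) :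
    frameComplexDet n (F * L) =
      (Matrix.of fun k j : Fin n =>
        ((F ⟨(k : ℕ), by omega⟩ ⟨(j : ℕ), by omega⟩ : ℤ) : ℂ) +
          ((F ⟨(k : ℕ) + n, by omega⟩ ⟨(j : ℕ), by omega⟩ : ℤ) : ℂ) * Complex.I).det *
      frameComplexDet n L := by
  have h := complexOf_mul F hF1 hF2 L id
  simp only [id_eq] at h
  unfold frameComplexDet
  rw [h, Matrix.det_mul]

/-- `η(L' R) = η(L') · det R` (column operations). [folklore] -/
theorem frameComplexDet_mul_right (L' : Matrix (Fin (2 * n)) (Fin n) ℤ) (R : Matrix (Fin n) (Fin n) ℤ) :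
    frameComplexDet n (L' * R) = frameComplexDet n L' * (R.det : ℂ) := by
  unfold frameComplexDet
  rw [Int.cast_det, ← Matrix.det_mul]
  congr 1
  ext k b
  simp only [Matrix.of_apply, Matrix.mul_apply, Matrix.map_apply]
  push_cast
  rw [Finset.sum_mul, ← Finset.sum_add_distrib]
  refine Finset.sum_congr rfl fun j _ => ?_
  ring

/-- **`det(A + iC) ≠ 0`** for a `J`-commuting integer `F = [[A, -C], [C, A]]` with `det F ≠ 0`:
`(A + iC) · (adjugate, complexified) = det F · 1`. [folklore] -/
theorem complexOf_det_ne_zero (F : Matrix (Fin (2 * n)) (Fin (2 * n)) ℤ)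
    (hF1 : ∀ a b : Fin n, F ⟨(a : ℕ) + n, by omega⟩ ⟨(b : ℕ) + n, by omega⟩ = F ⟨(a : ℕ), by omega⟩ ⟨(b : ℕ), by omega⟩)
    (hF2 : ∀ a b : Fin n, F ⟨(a : ℕ), by omega⟩ ⟨(b : ℕ) + n, by omega⟩ = -F ⟨(a : ℕ) + n, by omega⟩ ⟨(b : ℕ), by omega⟩)
    (hF : F.det ≠ 0) :
    (Matrix.of fun k j : Fin n =>
        ((F ⟨(k : ℕ), by omega⟩ ⟨(j : ℕ), by omega⟩ : ℤ) : ℂ) +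
          ((F ⟨(k : ℕ) + n, by omega⟩ ⟨(j : ℕ), by omega⟩ : ℤ) : ℂ) * Complex.I).det ≠ 0 := by
  have h := complexOf_mul F hF1 hF2 F.adjugate (fun b : Fin n => (⟨(b : ℕ), by omega⟩ : Fin (2 * n)))
  rw [Matrix.mul_adjugate] at h
  have h1 : (Matrix.of fun k b : Fin n =>
      (((F.det • (1 : Matrix (Fin (2 * n)) (Fin (2 * n)) ℤ)) ⟨(k : ℕ), by omega⟩ ⟨(b : ℕ), by omega⟩ : ℤ) : ℂ) +
        (((F.det • (1 : Matrix (Fin (2 * n)) (Fin (2 * n)) ℤ)) ⟨(k : ℕ) + n, by omega⟩ ⟨(b : ℕ), by omega⟩ : ℤ) : ℂ) *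
          Complex.I) = (F.det : ℂ) • (1 : Matrix (Fin n) (Fin n) ℂ) := by
    ext k b
    have hkb : (k : ℕ) + n ≠ (b : ℕ) := by omega
    by_cases hk : k = b
    · subst hk
      have hn : n ≠ 0 := by have := k.isLt; omega
      simp [Matrix.one_apply, Fin.ext_iff, hn]
    · have hkb' : (k : ℕ) ≠ (b : ℕ) := fun e => hk (Fin.ext e)
      simp [Matrix.one_apply, Fin.ext_iff, hk, hkb', hkb]
  rw [h1] at h
  intro hzero
  have h2 := congrArg Matrix.det h
  rw [Matrix.det_smul, Matrix.det_one, mul_one, Matrix.det_mul, hzero, zero_mul, Fintype.card_fin] at h2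
  exact pow_ne_zero n (by exact_mod_cast hF) h2

end Complex

end Summit.HodgeConjecture.HodgeConjecture.Theorems.TropicalWeilVanishing

end
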